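/-
Copyright: the b2b-balaban cell (near-miss cell 7), T⁴-continuum fan-out; row NE7b ROUND-2 swarm, seat
t4-ne7b-formalise-leaf-09 gen 9 (row S12o «CONCAVE ENTROPY REPAIR» of `t4/b2b-balaban-t4-ne7b-p1/LEAVES-NE7b.md`, part
(i-b) «the sibling-entropy PIVOT step», owner's division of labour journal l.17953 on R-OWNER-23-15; repair of leaf-10 g12's
FINDING F-leaf10g12-1, l.17801).  Released under the licence of the surrounding project.
-/
import Summits.QuantumFields.BalabanUV.T4Continuum.Support.HistoryJoinsEntropyBudget
import Summits.QuantumFields.BalabanUV.T4Continuum.Support.HistoryJoinsBudgetPivot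

/-!
# History joins, part 7′: the RANK-FREE budget RE-TELESCOPED WITH A PIVOT (row S12o part (i-b))

Summits-side support leaf of the T⁴-continuum cell (rung (B)+1 on a FINITE torus only; NOT infinite volume, NOT the
mass gap, NOT the Clay statement; NOT a proof of the spine estimate NE7b).  Row NE7b, route «COUNT»; smallness census
rows S12n∕S12o.  Twin of `HistoryJoinsEntropyBudget` (part 7, leaf-05 g2): the SAME carrier, the SAME functionals `mrg`, `MS`,
`ENT`, `NZP`, the SAME well-founded recursion — ONE arithmetic step changed.  [folklore] real arithmetic over the
lineage's own carrier; nothing is quoted from print, nothing printed is asserted, no `[cite:]` tag, no `Prop` fact, no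
constant of print; no END ∕ exit ∕ socket ∕ `HistoryConstants*` file is touched (c3); imports part 7 and leaf-10 g12's
TREE-FREE pivot lemmas `HistoryJoinsBudgetPivot` (row S12n (b′): `cost_le_pivot`, `classes_cost_le_pivot`, consumed BY
NAME — this file is the WIRING its header leaves to the owner's call: «re-telescoping `jW_le_budgetE` with
`2n + Z ↦ n·log W + Z∕W`»).

WHY (F-leaf10g12-1, census `HOME/b2b-balaban-t4-ne7b-formalise-leaf-10/g12/CENSUS-THETA-S12n.md`).  Part 7 charges a
join with `n − 1` non-host parts against its parts' total mass `Z` by the POINTWISE LINEARISATION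
`(n−1)·log Z − log (n−1)! ≤ 2(n−1) + Z` (`HistorySiblingEntropy.one_class_cost_le`), so `budgetE = exp(2·mrg + MS +
ENT)·NZP` and, downstream, `MS ≤ κM·F` puts the class-linear MASS constant `κM` itself into the exponent `Θ`.  The
concave form of the same step, with a free PIVOT `W > 0`,
  `K·log Z − log K! ≤ K·log W + Z∕W`       (`HistoryJoinsBudgetPivot.cost_le_pivot`, leaf-10 g12),
telescopes over the joins exactly as before and gives `budgetP W = exp(log W·mrg + MS∕W + ENT)·NZP`; with `mrg ≤ F`,
`MS ≤ κ·F` and the pivot `W := κ ≥ 1` the exponent is `(log κ + 1)·F + ENT` instead of `(2 + κ)·F + ENT` (§4).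

WHAT.
* §1 `cost_le_pivot_of_one_le` (`Z ≥ 0` allowed once `W ≥ 1`; at `Z = 0`, `W < 1` the pivot form is FALSE with Lean's
  `log 0 = 0` — decided control in §5), `joins_cost_le_pivot_of_budget` (twin of `HistorySiblingEntropy.joins_cost_le_of_budget`
  at a pivot `W ≥ 1`, masses `≥ 0`).
* §2 `jfac_le_exp_ent_pivot` (twin of `jfac_le_exp_ent`, every `W > 0`; the join's classes through leaf-10 g12's
  `classes_cost_le_pivot`).
* §3 `budgetP`, `budgetP_nonneg`, **`jW_le_budgetP`** (every shape tree, every pivot `W > 0`), **`card_S_le_budgetP`**.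
* §4 `budgetP_one_le_budgetE` (at `W = 1` the pivot budget is below part 7's), `pivot_exponent_le` (the class-linear
  corollary `log κ·m + s∕κ ≤ (log κ + 1)·F` under `m ≤ F`, `s ≤ κ·F`, `1 ≤ κ`), **`budgetP_le_of_linear`**, and the
  numeric sanity `example`s (`κ = e^{20}`: exponent `21·F` against part 7's `(2 + e^{20})·F`).

HONEST SCOPE.  A sharper bookkeeping inequality for OUR count; `ENT` displayed exactly as in part 7; which budget the
ENDs quote is the END lineages' choice (repair items (iii) distance term, (iv) re-pasting `Θ` through the END ∕ apex
files of F-leaf10g12-1 are NOT done here); the headline's Prop is unchanged by any of this (only the size of an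
∃-bound moves).  NE7b NOT proved; spine 0∕9.  HONEST DEPENDENCY (cell): continuum YM on T⁴ ⇐ BetaPertH ∧ nine spine
estimates (0/9 proved); BetaPertH ⇐ (D1) ∧ (D4) ∧ CAP+tail; G-an2-4 gates asym, D1 and NE2/3/4.  This file changes
none of it.
-/

open Finset
open Literature.MathematicalPhysics.QuantumFieldTheory.Balaban1983to89
open T4PersistenceDictionary T4PartnerMultiplicity T4BranchingRecordsGas
open Summit.QuantumFields.BalabanUV.T4Continuum.HistoryJoins
open Summit.QuantumFields.BalabanUV.T4Continuum.HistoryJoinsAdm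
open Summit.QuantumFields.BalabanUV.T4Continuum.HistoryJoinsCount
open Summit.QuantumFields.BalabanUV.T4Continuum.HistoryJoinsTotal
open Summit.QuantumFields.BalabanUV.T4Continuum.HistoryJoinsClass
open Summit.QuantumFields.BalabanUV.T4Continuum.HistoryJoinsBudget
open Summit.QuantumFields.BalabanUV.T4Continuum.HistorySiblingMass
open Summit.QuantumFields.BalabanUV.T4Continuum.HistorySiblingEntropy
open Summit.QuantumFields.BalabanUV.T4Continuum.HistoryJoinsEntropyBudget
open Summit.QuantumFields.BalabanUV.T4Continuum.HistoryJoinsBudgetPivot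

namespace Summit.QuantumFields.BalabanUV.T4Continuum.HistoryJoinsEntropyBudgetPivot

noncomputable section

open scoped Classical

/-! ## §1 The pivot inequality and its class ∕ join sums -/

section Pivot

variable {β : Type*}

/-- the pivot form for `Z ≥ 0` and a pivot `W ≥ 1` (at `Z = 0`: `−log K! ≤ 0 ≤ K·log W`; for `Z > 0` it is leaf-10 g12's
`cost_le_pivot`).  With Lean's `log 0 = 0` the hypothesis `1 ≤ W` cannot be dropped at `Z = 0` (§5 control). [folklore] -/
theorem cost_le_pivot_of_one_le (K : ℕ) {Z W : ℝ} (hZ : 0 ≤ Z) (hW : 1 ≤ W) :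
    (K : ℝ) * Real.log Z - Real.log (K.factorial : ℝ) ≤ (K : ℝ) * Real.log W + Z / W := by
  rcases hZ.eq_or_lt with hz | hz
  · rw [← hz, Real.log_zero, mul_zero, zero_div, zero_sub, add_zero]
    have h1 : 0 ≤ Real.log (K.factorial : ℝ) := Real.log_nonneg (by exact_mod_cast Nat.factorial_pos K)
    have h2 : 0 ≤ (K : ℝ) * Real.log W := mul_nonneg (Nat.cast_nonneg K) (Real.log_nonneg hW)
    linarith
  · exact cost_le_pivot K hz (zero_lt_one.trans_le hW)

/-- **OVER THE JOINS, WITH THE MASS BUDGET AND A PIVOT `W ≥ 1`**: joins `ℓ ∈ Ls` with classes of sizes `k ℓ g`, each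
join charged against its mass `Zp ℓ ≥ 0`, `Σ_ℓ Zp ℓ ≤ Ztot`:
`Σ_ℓ Σ_g (k·log (Zp ℓ) − log k!) ≤ log W·Σ_ℓ Σ_g k + Ztot∕W + Σ_ℓ logMultinomial` (twin of `joins_cost_le_of_budget`).
[folklore] -/
theorem joins_cost_le_pivot_of_budget {α : Type*} (Ls : Finset α) (Gs : α → Finset β) (k : α → β → ℕ) (Zp : α → ℝ)
    (hZ : ∀ ℓ ∈ Ls, 0 ≤ Zp ℓ) {Ztot W : ℝ} (hZtot : ∑ ℓ ∈ Ls, Zp ℓ ≤ Ztot) (hW : 1 ≤ W) :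
    ∑ ℓ ∈ Ls, ∑ g ∈ Gs ℓ, ((k ℓ g : ℝ) * Real.log (Zp ℓ) - Real.log ((k ℓ g).factorial : ℝ)) ≤
      Real.log W * ∑ ℓ ∈ Ls, ∑ g ∈ Gs ℓ, (k ℓ g : ℝ) + Ztot / W + ∑ ℓ ∈ Ls, logMultinomial (Gs ℓ) (k ℓ) := by
  have hW0 : 0 < W := zero_lt_one.trans_le hW
  have h1 : ∑ ℓ ∈ Ls, ∑ g ∈ Gs ℓ, ((k ℓ g : ℝ) * Real.log (Zp ℓ) - Real.log ((k ℓ g).factorial : ℝ)) ≤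
      ∑ ℓ ∈ Ls, ((∑ g ∈ Gs ℓ, (k ℓ g : ℝ)) * Real.log W + Zp ℓ / W + logMultinomial (Gs ℓ) (k ℓ)) := by
    refine sum_le_sum fun ℓ hℓ => ?_
    rw [classes_cost_eq]
    have h := cost_le_pivot_of_one_le (∑ g ∈ Gs ℓ, k ℓ g) (hZ ℓ hℓ) hW
    push_cast at h ⊢
    linarith
  have h2 : ∑ ℓ ∈ Ls, ((∑ g ∈ Gs ℓ, (k ℓ g : ℝ)) * Real.log W + Zp ℓ / W + logMultinomial (Gs ℓ) (k ℓ)) =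
      Real.log W * ∑ ℓ ∈ Ls, ∑ g ∈ Gs ℓ, (k ℓ g : ℝ) + (∑ ℓ ∈ Ls, Zp ℓ) / W +
        ∑ ℓ ∈ Ls, logMultinomial (Gs ℓ) (k ℓ) := by
    rw [mul_sum, sum_div, ← sum_add_distrib, ← sum_add_distrib]
    refine sum_congr rfl fun ℓ _ => ?_
    ring
  have h3 : (∑ ℓ ∈ Ls, Zp ℓ) / W ≤ Ztot / W := div_le_div_of_nonneg_right hZtot hW0.le
  linarith

end Pivot

/-! ## §2 The per-join factor against the exact split, with a pivot -/

variable {ε : Type*} (st : ε → ℕ) (M : ℕ → Gen ε → ℕ) (ext : ℕ → Gen ε → ℝ) (NZ : ℝ → ℕ → ℕ → ℕ)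

/-- **THE PER-JOIN FACTOR, RANK-FREE, WITH A PIVOT `W > 0`** (twin of `jfac_le_exp_ent`):
`jfac ≤ exp(log W·(r−1) + (Σ_j M t (part j))∕W + ent)·∏_{i≠h} NZ_i`. [folklore] -/
theorem jfac_le_exp_ent_pivot {W : ℝ} (hW : 0 < W) (X Y : Gen ε) (e : ε) :
    jfac st M ext NZ X Y e ≤
      Real.exp (Real.log W * ((npart st (Gen.merge X Y e) : ℝ) - 1) +
            (∑ j, (M (st e) (part st (Gen.merge X Y e) j).2 : ℝ)) / W + ent st X Y e) *
        ∏ i : {i // i ≠ hostIdx st X Y e},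
          (NZ (ext (st e) (part st (Gen.merge X Y e) i.1).2) (st e) (part st _ i.1).2.rootStep : ℝ) := by
  set n := npart st (Gen.merge X Y e)
  set Z : ℝ := ∑ j, (M (st e) (part st (Gen.merge X Y e) j).2 : ℝ)
  have hZ0 : 0 ≤ Z := sum_nonneg fun _ _ => Nat.cast_nonneg _
  have hNZ0 : 0 ≤ ∏ i : {i // i ≠ hostIdx st X Y e},
      (NZ (ext (st e) (part st (Gen.merge X Y e) i.1).2) (st e) (part st _ i.1).2.rootStep : ℝ) :=
    prod_nonneg fun _ _ => Nat.cast_nonneg _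
  have hn : 2 ≤ n := by
    have h1 := one_le_length_clusterParts st (st e) X
    have h2 := one_le_length_clusterParts st (st e) Y
    have : (jparts st (Gen.merge X Y e)).length =
        (clusterParts st (st e) X).length + (clusterParts st (st e) Y).length := by
      rw [jparts_merge, List.length_append, List.length_map, List.length_map]
    simp only [n, npart, this]; omega
  have hsym := symFac_pos st X Y e
  have hjfac : jfac st M ext NZ X Y e = Z ^ (n - 1) / symFac st X Y e *
      ∏ i : {i // i ≠ hostIdx st X Y e},
        (NZ (ext (st e) (part st (Gen.merge X Y e) i.1).2) (st e) (part st _ i.1).2.rootStep : ℝ) := by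
    unfold jfac; ring
  rw [hjfac]
  refine mul_le_mul_of_nonneg_right ?_ hNZ0
  rw [div_le_iff₀ hsym]
  rcases hZ0.eq_or_lt with hz | hz
  · -- no mass: the power vanishes
    rw [← hz, zero_pow (by omega)]
    exact mul_nonneg (Real.exp_pos _).le hsym.le
  · -- `Z^{r−1} ∕ symFac = exp(Σ_j (c_j log Z − log c_j!)) ≤ exp(log W·(r−1) + Z∕W + ent)`
    have hcost := classes_cost_le_pivot (univ : Finset (Fin n)) (csize st X Y e) hz hW
    have hlogsym : Real.log (symFac st X Y e) = ∑ j, Real.log ((csize st X Y e j).factorial : ℝ) := by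
      rw [symFac_eq_prod, Real.log_prod (hf := fun j _ => by exact_mod_cast (Nat.factorial_pos _).ne')]
    have hpow : Z ^ (n - 1) = Real.exp (((n - 1 : ℕ) : ℝ) * Real.log Z) := by
      rw [Real.exp_nat_mul, Real.exp_log hz]
    have hexp : Z ^ (n - 1) = Real.exp (∑ j, ((csize st X Y e j : ℝ) * Real.log Z -
        Real.log ((csize st X Y e j).factorial : ℝ))) * symFac st X Y e := by
      rw [sum_sub_distrib, ← sum_mul, ← Nat.cast_sum, sum_csize, ← hlogsym, Real.exp_sub, Real.exp_log hsym, hpow,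
        div_mul_cancel₀ _ hsym.ne']
    rw [hexp]
    refine mul_le_mul_of_nonneg_right (Real.exp_le_exp.2 ?_) hsym.le
    have hcast : ((n - 1 : ℕ) : ℝ) = (n : ℝ) - 1 := by rw [Nat.cast_sub (by omega), Nat.cast_one]
    calc ∑ j, ((csize st X Y e j : ℝ) * Real.log Z - Real.log ((csize st X Y e j).factorial : ℝ))
        ≤ ((∑ j, csize st X Y e j : ℕ) : ℝ) * Real.log W + Z / W + logMultinomial univ (csize st X Y e) := hcost
      _ = Real.log W * ((n : ℝ) - 1) + Z / W + ent st X Y e := by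
          rw [sum_csize, hcast, mul_comm]; rfl

/-! ## §3 The pivot budget and the telescoping over the joins -/

/-- **THE PIVOT BUDGET**: `exp(log W·mrg + MS∕W + ENT)·NZP`. [folklore] -/
def budgetP (W : ℝ) (G : Gen ε) : ℝ := Real.exp (Real.log W * mrg st G + MS st M G / W + ENT st G) * NZP st ext NZ G

/-- the pivot budget is nonnegative [folklore] -/
theorem budgetP_nonneg (W : ℝ) (G : Gen ε) : 0 ≤ budgetP st M ext NZ W G :=
  mul_nonneg (Real.exp_pos _).le (NZP_nonneg st ext NZ G)

/-- **`jW ≤ budgetP W`** for EVERY shape tree and EVERY pivot `W > 0` — the same well-founded telescoping as part 7's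
`jW_le_budgetE`, with `jfac_le_exp_ent_pivot` at each join. [folklore] -/
theorem jW_le_budgetP {W : ℝ} (hW : 0 < W) : ∀ G : Gen ε, jW st M ext NZ G ≤ budgetP st M ext NZ W G
  | Gen.born b j => by simp [budgetP, jW_born, mrg, MS, ENT, NZP]
  | Gen.renew G e h => by
      rw [jW_renew, budgetP, mrg, MS, ENT, NZP]
      exact jW_le_budgetP hW G
  | Gen.merge X Y e => by
      have ih : ∀ i : Fin (npart st (Gen.merge X Y e)),
          jW st M ext NZ (part st _ i).2 ≤ budgetP st M ext NZ W (part st _ i).2 :=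
        fun i => jW_le_budgetP hW (part st _ i).2
      have hj := jfac_le_exp_ent_pivot st M ext NZ hW X Y e
      rw [jW_merge, budgetP, mrg, MS, ENT, NZP]
      have h1 : jfac st M ext NZ X Y e * ∏ i, jW st M ext NZ (part st (Gen.merge X Y e) i).2 ≤
          (Real.exp (Real.log W * ((npart st (Gen.merge X Y e) : ℝ) - 1) +
              (∑ j, (M (st e) (part st (Gen.merge X Y e) j).2 : ℝ)) / W + ent st X Y e) *
            ∏ i : {i // i ≠ hostIdx st X Y e},
              (NZ (ext (st e) (part st (Gen.merge X Y e) i.1).2) (st e) (part st _ i.1).2.rootStep : ℝ)) *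
          ∏ i, budgetP st M ext NZ W (part st (Gen.merge X Y e) i).2 :=
        mul_le_mul hj (prod_le_prod (fun i _ => jW_nonneg st M ext NZ _) fun i _ => ih i)
          (prod_nonneg fun i _ => jW_nonneg st M ext NZ _)
          (mul_nonneg (Real.exp_pos _).le (prod_nonneg fun _ _ => Nat.cast_nonneg _))
      refine h1.trans (le_of_eq ?_)
      simp only [budgetP]
      rw [prod_mul_distrib, ← Real.exp_sum, sum_add_distrib, sum_add_distrib, ← mul_sum, ← sum_div,
        mul_mul_mul_comm, ← Real.exp_add]
      congr 1
      congr 1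
      ring
termination_by G => gsize G
decreasing_by
  · simp [gsize]
  · exact gsize_lt_of_mem_jparts st _ _ (part_mem st _ i)

/-- **THE COUNT AGAINST THE PIVOT BUDGET**: `#S G z ≤ exp(log W·mrg + MS∕W + ENT)·NZP` for every `W > 0` (part 6's
`card_S_le_jW`, then `jW_le_budgetP`). [folklore] -/
theorem card_S_le_budgetP {γ β R : Type*} [DecidableEq β] [LinearOrder R] [Fintype γ] {D : ℕ}
    (zone : ℕ → Gen ε → (Addr D → γ) → Finset β) (ρ : (Addr D → γ) → R) (c₀ : γ)
    (near : β → ℕ → γ → ℕ → ℝ → Prop)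
    (hcard : ∀ (t : ℕ) (Z : Gen ε) (p : Addr D → γ), p ∈ Sany zone ρ c₀ st Z → (zone t Z p).card ≤ M t Z)
    (hloc : ∀ (t : ℕ) (Z : Gen ε) (p : Addr D → γ) (u : β), p ∈ Sany zone ρ c₀ st Z → u ∈ zone t Z p →
      near u t (evalA c₀ p (rootAddr Z)) Z.rootStep (ext t Z))
    (hNZ : ∀ (u : β) (t s : ℕ) (r : ℝ), (univ.filter fun y : γ => near u t y s r).card ≤ NZ r t s)
    {W : ℝ} (hW : 0 < W) (G : Gen ε) (z : γ) : ((S zone ρ c₀ st G z).card : ℝ) ≤ budgetP st M ext NZ W G :=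
  (card_S_le_jW zone ρ c₀ st M ext NZ near hcard hloc hNZ G z).trans (jW_le_budgetP st M ext NZ hW G)

/-! ## §4 Comparison with part 7 and the class-linear corollary -/

/-- `mrg ≥ 0` [folklore] -/
theorem mrg_nonneg : ∀ G : Gen ε, 0 ≤ mrg st G
  | Gen.born _ _ => by simp [mrg]
  | Gen.renew G _ _ => by rw [mrg]; exact mrg_nonneg G
  | Gen.merge X Y e => by
      rw [mrg]
      refine add_nonneg ?_ (sum_nonneg fun i _ => mrg_nonneg (part st _ i).2)
      have : 1 ≤ npart st (Gen.merge X Y e) := by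
        have h1 := one_le_length_clusterParts st (st e) X
        have : (jparts st (Gen.merge X Y e)).length =
            (clusterParts st (st e) X).length + (clusterParts st (st e) Y).length := by
          rw [jparts_merge, List.length_append, List.length_map, List.length_map]
        simp only [npart, this]; omega
      have : (1 : ℝ) ≤ npart st (Gen.merge X Y e) := by exact_mod_cast this
      linarith
termination_by G => gsize G
decreasing_by
  · simp [gsize]
  · exact gsize_lt_of_mem_jparts st _ _ (part_mem st _ i)

/-- **AT THE PIVOT `W = 1` THE PIVOT BUDGET IS BELOW PART 7's**: `exp(MS + ENT)·NZP ≤ exp(2·mrg + MS + ENT)·NZP`.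
[folklore] -/
theorem budgetP_one_le_budgetE (G : Gen ε) : budgetP st M ext NZ 1 G ≤ budgetE st M ext NZ G := by
  unfold budgetP budgetE
  refine mul_le_mul_of_nonneg_right (Real.exp_le_exp.2 ?_) (NZP_nonneg st ext NZ G)
  rw [Real.log_one, zero_mul, div_one, zero_add]
  have := mrg_nonneg st G
  linarith

/-- **THE CLASS-LINEAR COROLLARY OF THE PIVOT** (real arithmetic): `m ≤ F`, `s ≤ κ·F`, `1 ≤ κ` ⊢
`log κ·m + s∕κ ≤ (log κ + 1)·F`. [folklore] -/
theorem pivot_exponent_le {m s κ F : ℝ} (hm : m ≤ F) (hs : s ≤ κ * F) (hκ : 1 ≤ κ) :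
    Real.log κ * m + s / κ ≤ (Real.log κ + 1) * F := by
  have hκ0 : 0 < κ := zero_lt_one.trans_le hκ
  have h1 : Real.log κ * m ≤ Real.log κ * F := mul_le_mul_of_nonneg_left hm (Real.log_nonneg hκ)
  have h2 : s / κ ≤ F := by rw [div_le_iff₀ hκ0]; linarith [mul_comm κ F]
  linarith

/-- **THE PIVOT BUDGET UNDER CLASS-LINEAR BOUNDS**: `mrg G ≤ F`, `MS G ≤ κ·F`, `1 ≤ κ` ⊢
`budgetP κ G ≤ exp((log κ + 1)·F + ENT G)·NZP G` — against part 7's `exp((2 + κ)·F + ENT)·NZP` from the same two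
bounds. [folklore] -/
theorem budgetP_le_of_linear {κ F : ℝ} (hκ : 1 ≤ κ) (G : Gen ε) (hmrg : mrg st G ≤ F) (hMS : MS st M G ≤ κ * F) :
    budgetP st M ext NZ κ G ≤ Real.exp ((Real.log κ + 1) * F + ENT st G) * NZP st ext NZ G := by
  unfold budgetP
  refine mul_le_mul_of_nonneg_right (Real.exp_le_exp.2 ?_) (NZP_nonneg st ext NZ G)
  have := pivot_exponent_le hmrg hMS hκ
  linarith

/-- … and part 7's budget under the same two bounds, for comparison: `budgetE G ≤ exp((2 + κ)·F + ENT G)·NZP G`.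
[folklore] -/
theorem budgetE_le_of_linear {κ F : ℝ} (G : Gen ε) (hmrg : mrg st G ≤ F) (hMS : MS st M G ≤ κ * F) :
    budgetE st M ext NZ G ≤ Real.exp ((2 + κ) * F + ENT st G) * NZP st ext NZ G := by
  unfold budgetE
  refine mul_le_mul_of_nonneg_right (Real.exp_le_exp.2 ?_) (NZP_nonneg st ext NZ G)
  nlinarith

/-! ## §5 Sanity (numerals here only; nothing of print) -/

/-- the pivot inequality at `K = 2`, `Z = 8`, `W = 2`: `2·log 8 − log 2 ≤ 2·log 2 + 4`, i.e. `4·log 2 ≤ 4 + …` — an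
instance of §1, checked through the lemma (not numerically). -/
example : (2 : ℝ) * Real.log 8 - Real.log ((2 : ℕ).factorial : ℝ) ≤ (2 : ℝ) * Real.log 2 + 8 / 2 := by
  have h := cost_le_pivot 2 (Z := 8) (W := 2) (by norm_num) (by norm_num)
  exact_mod_cast h

/-- the class-linear corollary at `κ = exp 20` (so `log κ = 20`): exponent slope `21` against part 7's `2 + exp 20`. -/
example {m s F : ℝ} (hm : m ≤ F) (hs : s ≤ Real.exp 20 * F) :
    Real.log (Real.exp 20) * m + s / Real.exp 20 ≤ 21 * F := by
  have h := pivot_exponent_le hm hs (Real.one_le_exp (by norm_num : (0 : ℝ) ≤ 20))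
  rw [Real.log_exp] at h ⊢
  linarith

/-- CONTROL: the pivot form is FALSE at `Z = 0` without `1 ≤ W` (Lean's `log 0 = 0`): `K = 1`, `W = e^{−1}` gives
`0 ≤ −1`. -/
example : ¬ ∀ (K : ℕ) (Z W : ℝ), 0 ≤ Z → 0 < W →
    (K : ℝ) * Real.log Z - Real.log (K.factorial : ℝ) ≤ (K : ℝ) * Real.log W + Z / W := by
  intro h
  have h1 := h 1 0 (Real.exp (-1)) le_rfl (Real.exp_pos _)
  simp only [Nat.cast_one, Real.log_zero, mul_zero, Nat.factorial_one, Real.log_one, sub_zero, one_mul,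
    Real.log_exp, zero_div, add_zero] at h1
  linarith

end

end Summit.QuantumFields.BalabanUV.T4Continuum.HistoryJoinsEntropyBudgetPivot
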